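import Mathlib
import Summits.Ventures.HodgeRepro.Tier4.Target
import Summits.Ventures.HodgeRepro.Tier4.Common.AutForms
import Summits.Ventures.HodgeRepro.Tier4.Line3.KMDatum
import Summits.Ventures.HodgeRepro.Tier4.Line3.KMDatumS
import Summits.Ventures.HodgeRepro.Tier4.Line3.Defs
import Summits.Ventures.HodgeRepro.Tier4.Line3.CopyWeightGaussian
import Summits.Ventures.HodgeRepro.Tier4.Line3.DatumOrthVanishing
import Summits.Ventures.HodgeRepro.Tier4.Line3.HeckeEquivarianceLemmas
import Summits.Ventures.HodgeRepro.Tier4.Line3.KernelIntegralPos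
import Summits.Ventures.HodgeRepro.Tier4.Line3.HKRayReduction
import Summits.Ventures.HodgeRepro.Tier4.Line3.SlotFunctionAlgebra
import Summits.Ventures.HodgeRepro.Tier4.Line3.ModelIntegrand
import Summits.Ventures.HodgeRepro.Tier4.Line3.ShapeIntegrandBounds
import Summits.Ventures.HodgeRepro.Tier4.Line3.ShapeIntegralBounds

/-!
# Tier4/Line3/DilationComparisonOfShape — the dilation comparison (HK′ along the ray) from the Kudla–Millson SHAPE

Blind re-derivation cell `pub-hodge-repro`, Tier 4 «PROVE THE STEP» (README §9–§10), LINE L3, seat t4-L3-p1 (gen 3),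
self-cut C-L3-DILCOMP (bus S14565), module 5 of 5: the analytic half of HKRAY-x2.md §5 (F8), typed.  The chain:
`Line3/SlotFunctionAlgebra` (§1–2) → `Line3/ModelIntegrand` (§3–5) → `Line3/ShapeIntegrandBounds` (§6) →
`Line3/ShapeIntegralBounds` (§7) → this module (§8, the assembly and the `T4Data` statement).

THE STATEMENT.  `T4Data.exists_dilationComparison_of_shape`: for a datum `D : X.ThetaData` and a symmetric centre `xm`
whose first two ball coordinates `y_j = ballCoord (xm j)` have independent first coordinates (`hab`) and span a
`J`-positive plane (`hpos`), and whose Gaussian-free part `gaussFree D xm` (HKRayReduction) has on the ball the SHAPE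

  `gaussFree D xm z = κ · ‖f₀(z)‖² ‖f₁(z)‖² / g(z)⁴ · ‖W z‖²`,  `f_j(z) = w_z^* J y_j`,  `g(z) = 1 − nsq z`,

with `κ ≥ 0` and `W` continuous on the ball, `‖W‖ ≤ C₁ + C₂/g` (`C₁, C₂ ≥ 0`) and `W ≠ 0` at every common zero of
`f₀, f₁` in the ball, there are `A, k ≥ 0` with `DilationComparison D xm A k`:
`∫_𝔹 dilInt (λa) (λb) ≤ A (2/a)^k (2/b)^k ∫_𝔹 dilInt (2λ) (2λ)` for all `λ ≥ 1`, `a, b ∈ (0, 2]`, together with the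
integrability of the left integrand.  (The proof gives `k = 6`.)  This is exactly the shape that x2's rigidity
(`OriginRigidity` + `Transvection`, `kernel_eq_kmKernel`) gives for every `ThetaData` (`κ = |c|⁴`,
`W = conj(det Y) + (conj(f₁) wedge(conj y'₀, conj z) − conj(f₀) wedge(conj y'₁, conj z))/g`), so the (HK′) clause of the
ray displays becomes a theorem modulo that algebraic identity (the glue is a separate module).

THE PROOF (paper note proofs/t4/L3/DILCOMP-L3-p1.md).
1. `f_j(z) = ℓ_j(z − z*)` with `ℓ_j(w) = conj(w₀) y_j₀ + conj(w₁) y_j₁` (conjugate-linear), `z*` the common zero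
   (Cramer, §2); `z* ∈ 𝔹` because the `J`-orthogonal line of a `J`-positive plane is negative (`commonZero_mem_ball`).
   Cramer bounds: `‖Δ‖² (‖w₀‖² + ‖w₁‖²) ≤ 4N (‖ℓ₀ w‖² + ‖ℓ₁ w‖²)` (`sq_le_slotLin_sq`, `coercive_slotLin`).
2. The shape integrand `shapeInt` and the model integrand `modelInt c w = ‖ℓ₀ w‖² ‖ℓ₁ w‖² e^{−c(‖ℓ₀ w‖² + ‖ℓ₁ w‖²)}`;
   dilation by `√s` (`Measure.integral_comp_smul`, `finrank ℝ ℂ² = 4`) gives `∫_{B(0,r)} modelInt (cs) = s⁻⁴ ∫_{B(0,√s r)} modelInt c`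
   and the same on `ℂ²` (§4); `modelInt c ≤ (2/c²) e^{−cσ²S/2}` is Gaussian-dominated, hence integrable on `ℂ²`
   (`GaussianFourier.integrable_cexp_neg_mul_sq_norm_add` on `ℂ`, `Integrable.fintype_prod`), and its integral over
   every ball `B(0, r)` is positive (§5).
3. On a sup-norm ball `B(z*, r) ⊆ 𝔹` where `g ≥ g(z*)/2` and `‖W‖² ≥ ‖W(z*)‖²/2` (continuity, §7): pointwise
   `w₀ · modelInt (4πs/g₀) (z − z*) ≤ shapeInt (2s) (2s) z ≤ g₀⁻⁴ (C₁ + C₂/g₀)² · modelInt (4πs) (z − z*)` (§6).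
   Off that ball, `‖f‖² ≥ σ² r²` and, with `t = 1/g ≥ 1`, `shapeInt α β ≤ B₀² B₁² (C₁+C₂)² t⁶ e^{−2π σ² r² m t}
   ≤ B₀² B₁² (C₁+C₂)² · 720/(2π σ² r² m)⁶` for `m ≤ α, β` (`Real.pow_div_factorial_le_exp`, §6).
4. Hence (§7) `shapeInt α β` is integrable on `𝔹` for all `α, β > 0`, and with `Φ(s) = ∫_𝔹 shapeInt (2s) (2s)`:
   `c s⁻⁴ ≤ Φ(s)` for `s ≥ 1` (`c > 0`) and `Φ(s) ≤ A₁ s⁻⁴ + A₂ s⁻⁶` for all `s > 0`.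
5. Assembly (§8): `I(λa, λb) ≤ I(λt, λt) = Φ(λt/2)`, `t = min(a, b)` (monotonicity), and
   `Φ(λt/2) ≤ (A₁ + A₂)/c · (2/t)⁶ · Φ(λ) ≤ (A₁+A₂)/c · (2/a)⁶ (2/b)⁶ · Φ(λ)`.

Imports: Mathlib and Tier-4 modules of this cell by name (Target, Line3.{KMDatum, KMDatumS, Defs, CopyWeightGaussian,
DatumOrthVanishing, HeckeEquivarianceLemmas, KernelIntegralPos, HKRayReduction} and the four modules of the chain).  `#print axioms` of every theorem =
`[propext, Classical.choice, Quot.sound]`.  No printed input is consumed.  Nothing here asserts anything about the truth of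
(P); HC_CM is NOT proved by anyone in this repository.
-/

set_option autoImplicit false

noncomputable section

namespace Summit.Ventures.HodgeRepro.Tier4.Line3

open Summit.Ventures.HodgeRepro.Tier4
open Matrix MeasureTheory
open scoped ComplexConjugate

/-! ## 8. Assembly: the comparison for the shape integrand, then for `dilInt` of a datum with the Kudla–Millson shape -/

/-- The real-number assembly: from `Φ(μ) ≤ A₁ μ⁻⁴ + A₂ μ⁻⁶` at `μ = λt/2` and `c λ⁻⁴ ≤ Φ(λ)` to
`Φ(μ) ≤ (A₁ + A₂)/c · (2/t)⁶ · Φ(λ)` (`λ ≥ 1`, `0 < t ≤ 2`). -/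
theorem assembly_aux {A₁ A₂ c lam t Φμ Φ : ℝ} (hA₁ : 0 ≤ A₁) (hA₂ : 0 ≤ A₂) (hc : 0 < c) (hlam : 1 ≤ lam)
    (ht : 0 < t) (ht2 : t ≤ 2) (hup : Φμ ≤ A₁ * ((lam * t / 2) ^ 4)⁻¹ + A₂ * ((lam * t / 2) ^ 6)⁻¹)
    (hlow : c * (lam ^ 4)⁻¹ ≤ Φ) : Φμ ≤ (A₁ + A₂) / c * (2 / t) ^ 6 * Φ := by
  have hl0 : lam ≠ 0 := by positivity
  have ht0 : t ≠ 0 := ht.ne'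
  have e4 : ((lam * t / 2) ^ 4)⁻¹ = (2 / t) ^ 4 * (lam ^ 4)⁻¹ := by
    field_simp
  have e6 : ((lam * t / 2) ^ 6)⁻¹ = (2 / t) ^ 6 * (lam ^ 6)⁻¹ := by
    field_simp
  have hq : 1 ≤ 2 / t := by rw [le_div_iff₀ ht]; linarith
  have hq4 : (2 / t) ^ 4 ≤ (2 / t) ^ 6 := pow_le_pow_right₀ hq (by norm_num)
  have hl : (lam ^ 6)⁻¹ ≤ (lam ^ 4)⁻¹ := by
    rw [inv_le_inv₀ (by positivity) (by positivity)]
    exact pow_le_pow_right₀ hlam (by norm_num)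
  have hlam4 : (lam ^ 4)⁻¹ ≤ Φ / c := by
    rw [le_div_iff₀ hc]; linarith
  have h4 : 0 ≤ (lam ^ 4)⁻¹ := by positivity
  have h6 : 0 ≤ (2 / t) ^ 6 := by positivity
  calc Φμ ≤ A₁ * ((2 / t) ^ 4 * (lam ^ 4)⁻¹) + A₂ * ((2 / t) ^ 6 * (lam ^ 6)⁻¹) := by rw [← e4, ← e6]; exact hup
    _ ≤ A₁ * ((2 / t) ^ 6 * (lam ^ 4)⁻¹) + A₂ * ((2 / t) ^ 6 * (lam ^ 4)⁻¹) := by gcongr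
    _ = (A₁ + A₂) * (2 / t) ^ 6 * (lam ^ 4)⁻¹ := by ring
    _ ≤ (A₁ + A₂) * (2 / t) ^ 6 * (Φ / c) := by gcongr
    _ = (A₁ + A₂) / c * (2 / t) ^ 6 * Φ := by ring

/-- `(2/min a b)⁶ ≤ (2/a)⁶ (2/b)⁶` for `a, b ∈ (0, 2]`. -/
theorem two_div_min_pow_le {a b : ℝ} (ha : 0 < a) (ha2 : a ≤ 2) (hb : 0 < b) (hb2 : b ≤ 2) :
    (2 / min a b) ^ 6 ≤ (2 / a) ^ 6 * (2 / b) ^ 6 := by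
  have hqa : 1 ≤ 2 / a := by rw [le_div_iff₀ ha]; linarith
  have hqb : 1 ≤ 2 / b := by rw [le_div_iff₀ hb]; linarith
  rcases min_choice a b with h | h <;> rw [h]
  · exact le_mul_of_one_le_right (by positivity) (one_le_pow₀ hqb)
  · exact le_mul_of_one_le_left (by positivity) (one_le_pow₀ hqa)

/-- **THE DILATION COMPARISON FOR THE SHAPE INTEGRAND:** for a `J`-positive plane with `hab`, every continuous `W`
on the ball with `‖W‖ ≤ C₁ + C₂/g` and `W(z*) ≠ 0`, there are `A ≥ 0`, `k ≥ 0` (here `k = 6`) with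
`∫_𝔹 shapeInt (λa) (λb) ≤ A (2/a)^k (2/b)^k ∫_𝔹 shapeInt (2λ) (2λ)` for all `λ ≥ 1`, `a, b ∈ (0, 2]`,
together with the integrability of the left integrand. -/
theorem exists_shape_comparison (y₀ y₁ : Fin 3 → ℂ) (hab : y₀ 0 * y₁ 1 - y₀ 1 * y₁ 0 ≠ 0)
    (hpos : ∀ u v : ℂ, (u ≠ 0 ∨ v ≠ 0) →
      0 < (star (u • y₀ + v • y₁) ⬝ᵥ (J *ᵥ (u • y₀ + v • y₁))).re)
    (W : (Fin 2 → ℂ) → ℂ) (hWc : ContinuousOn W ball) {C₁ C₂ : ℝ} (hC₁ : 0 ≤ C₁) (hC₂ : 0 ≤ C₂)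
    (hWb : ∀ z ∈ ball, ‖W z‖ ≤ C₁ + C₂ / (1 - nsq z)) (hW0 : W (commonZero y₀ y₁) ≠ 0) :
    ∃ A k : ℝ, 0 ≤ A ∧ 0 ≤ k ∧ ∀ lam : ℝ, 1 ≤ lam → ∀ a b : ℝ, 0 < a → a ≤ 2 → 0 < b → b ≤ 2 →
      IntegrableOn (shapeInt y₀ y₁ W (lam * a) (lam * b)) ball ∧
      ∫ z in ball, shapeInt y₀ y₁ W (lam * a) (lam * b) z ≤
        A * (2 / a) ^ k * (2 / b) ^ k * ∫ z in ball, shapeInt y₀ y₁ W (2 * lam) (2 * lam) z := by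
  obtain ⟨c, hc, hlow⟩ := exists_lower_bound y₀ y₁ hab hpos W hWc hC₁ hC₂ hWb hW0
  obtain ⟨A₁, A₂, hA₁, hA₂, hup⟩ := exists_upper_bound y₀ y₁ hab hpos W hWc hC₁ hC₂ hWb hW0
  refine ⟨(A₁ + A₂) / c, 6, by positivity, by norm_num, fun lam hlam a b ha ha2 hb hb2 => ?_⟩
  have hlam0 : 0 < lam := by linarith
  have ht : 0 < min a b := lt_min ha hb
  have ht2 : min a b ≤ 2 := (min_le_left a b).trans ha2
  have hint : IntegrableOn (shapeInt y₀ y₁ W (lam * a) (lam * b)) ball :=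
    integrableOn_shapeInt y₀ y₁ hab hpos W hWc hC₁ hC₂ hWb hW0 (by positivity) (by positivity)
  refine ⟨hint, ?_⟩
  have hintt : IntegrableOn (shapeInt y₀ y₁ W (lam * min a b) (lam * min a b)) ball :=
    integrableOn_shapeInt y₀ y₁ hab hpos W hWc hC₁ hC₂ hWb hW0 (by positivity) (by positivity)
  -- monotonicity: the integrand at `(λa, λb)` is below the one at `(λt, λt)`, `t = min a b`
  have hmono : ∫ z in ball, shapeInt y₀ y₁ W (lam * a) (lam * b) z ≤
      ∫ z in ball, shapeInt y₀ y₁ W (lam * min a b) (lam * min a b) z :=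
    setIntegral_mono_on hint hintt isOpen_ball.measurableSet fun z hz =>
      shapeInt_anti y₀ y₁ W (mul_le_mul_of_nonneg_left (min_le_left a b) hlam0.le)
        (mul_le_mul_of_nonneg_left (min_le_right a b) hlam0.le) hz
  have hμ : lam * min a b = 2 * (lam * min a b / 2) := by ring
  have hupμ := hup (lam * min a b / 2) (by positivity)
  rw [← hμ] at hupμ
  have hlowL := hlow lam hlam
  have key := assembly_aux hA₁ hA₂ hc hlam ht ht2 (hmono.trans hupμ) hlowL
  have hpow : ∀ x : ℝ, x ^ (6 : ℝ) = x ^ 6 := fun x => by norm_cast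
  rw [hpow, hpow]
  have hΦ : 0 ≤ ∫ z in ball, shapeInt y₀ y₁ W (2 * lam) (2 * lam) z :=
    setIntegral_nonneg isOpen_ball.measurableSet fun z _ => shapeInt_nonneg y₀ y₁ W _ _ z
  calc ∫ z in ball, shapeInt y₀ y₁ W (lam * a) (lam * b) z
      ≤ (A₁ + A₂) / c * (2 / min a b) ^ 6 * ∫ z in ball, shapeInt y₀ y₁ W (2 * lam) (2 * lam) z := key
    _ ≤ (A₁ + A₂) / c * ((2 / a) ^ 6 * (2 / b) ^ 6) * ∫ z in ball, shapeInt y₀ y₁ W (2 * lam) (2 * lam) z := by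
        gcongr
        exact two_div_min_pow_le ha ha2 hb hb2
    _ = (A₁ + A₂) / c * (2 / a) ^ 6 * (2 / b) ^ 6 * ∫ z in ball, shapeInt y₀ y₁ W (2 * lam) (2 * lam) z := by
        ring

namespace T4Data

variable (X : T4Data)

/-- `tauSize x = (y^* J y).re` at the ball coordinates `y = y(x)` when the latter is positive
(`norm_ballCoord_J` + `norm_hformJ_eq_abs_re`). -/
theorem tauSize_eq_re_of_jpos (x : Fin 3 → X.E)
    (h : 0 < (star (X.ballCoord x) ⬝ᵥ (J *ᵥ X.ballCoord x)).re) :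
    X.tauSize x = (star (X.ballCoord x) ⬝ᵥ (J *ᵥ X.ballCoord x)).re := by
  unfold tauSize
  rw [← X.norm_ballCoord_J, norm_hformJ_eq_abs_re, abs_of_pos h]

/-- The reduced majorant of slot `j` is `2 ‖f_j(z)‖² / g(z)` when `y_j^* J y_j > 0`. -/
theorem redMaj_eq_of_pos (xm : X.Tuple) (j : Fin 4)
    (h : 0 < (star (X.ballCoord (xm j)) ⬝ᵥ (J *ᵥ X.ballCoord (xm j))).re) (z : Fin 2 → ℂ) :
    X.redMaj xm j z = 2 * ‖star (lift3 z) ⬝ᵥ (J *ᵥ X.ballCoord (xm j))‖ ^ 2 / (1 - nsq z) := by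
  unfold redMaj maj
  rw [X.tauSize_eq_re_of_jpos (xm j) h]
  ring

/-- The `J`-positivity of the plane at its two basis vectors. -/
theorem jpos_slots (xm : X.Tuple)
    (hpos : ∀ u v : ℂ, (u ≠ 0 ∨ v ≠ 0) →
      0 < (star (u • X.ballCoord (xm 0) + v • X.ballCoord (xm 1)) ⬝ᵥ
        (J *ᵥ (u • X.ballCoord (xm 0) + v • X.ballCoord (xm 1)))).re) :
    0 < (star (X.ballCoord (xm 0)) ⬝ᵥ (J *ᵥ X.ballCoord (xm 0))).re ∧
    0 < (star (X.ballCoord (xm 1)) ⬝ᵥ (J *ᵥ X.ballCoord (xm 1))).re := by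
  constructor
  · have := hpos 1 0 (Or.inl one_ne_zero)
    simpa using this
  · have := hpos 0 1 (Or.inr one_ne_zero)
    simpa using this

/-- Under the shape hypothesis, `dilInt D xm α β = κ · shapeInt y₀ y₁ W α β` on the ball. -/
theorem dilInt_eq_shapeInt (D : X.ThetaData) (xm : X.Tuple)
    (hpos : ∀ u v : ℂ, (u ≠ 0 ∨ v ≠ 0) →
      0 < (star (u • X.ballCoord (xm 0) + v • X.ballCoord (xm 1)) ⬝ᵥ
        (J *ᵥ (u • X.ballCoord (xm 0) + v • X.ballCoord (xm 1)))).re)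
    (W : (Fin 2 → ℂ) → ℂ) (κ : ℝ)
    (hP : ∀ z ∈ ball, X.gaussFree D xm z =
      κ * (‖star (lift3 z) ⬝ᵥ (J *ᵥ X.ballCoord (xm 0))‖ ^ 2 * ‖star (lift3 z) ⬝ᵥ (J *ᵥ X.ballCoord (xm 1))‖ ^ 2 /
        (1 - nsq z) ^ 4 * ‖W z‖ ^ 2))
    (α β : ℝ) {z : Fin 2 → ℂ} (hz : z ∈ ball) :
    X.dilInt D xm α β z = κ * shapeInt (X.ballCoord (xm 0)) (X.ballCoord (xm 1)) W α β z := by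
  obtain ⟨h0, h1⟩ := X.jpos_slots xm hpos
  unfold dilInt shapeInt
  rw [hP z hz, X.redMaj_eq_of_pos xm 0 h0, X.redMaj_eq_of_pos xm 1 h1]
  ring

/-- **THE DILATION COMPARISON FROM THE KUDLA–MILLSON SHAPE (C-L3-DILCOMP):** for a datum `D` whose Gaussian-free
part at the centre `xm` has the shape `κ · ‖f₀‖² ‖f₁‖² g^{-4} ‖W‖²` on the ball (`f_j(z) = w_z^* J y_j`,
`g = 1 − nsq z`, `W` continuous on the ball, `‖W‖ ≤ C₁ + C₂/g`, `W ≠ 0` at the common zero of `f₀, f₁`, `κ ≥ 0`),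
with `hab` (independent first coordinates) and `hpos` (`J`-positive plane), there are `A, k ≥ 0` with
`DilationComparison D xm A k` (HKRayReduction): `I(λa, λb) ≤ A (2/a)^k (2/b)^k I(2λ, 2λ)` for all `λ ≥ 1`,
`a, b ∈ (0, 2]`, with the integrability of the left integrand.  The proof gives `k = 6`. -/
theorem exists_dilationComparison_of_shape (D : X.ThetaData) (xm : X.Tuple)
    (hab : X.ballCoord (xm 0) 0 * X.ballCoord (xm 1) 1 - X.ballCoord (xm 0) 1 * X.ballCoord (xm 1) 0 ≠ 0)
    (hpos : ∀ u v : ℂ, (u ≠ 0 ∨ v ≠ 0) →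
      0 < (star (u • X.ballCoord (xm 0) + v • X.ballCoord (xm 1)) ⬝ᵥ
        (J *ᵥ (u • X.ballCoord (xm 0) + v • X.ballCoord (xm 1)))).re)
    (W : (Fin 2 → ℂ) → ℂ) (hWc : ContinuousOn W ball) (C₁ C₂ : ℝ) (hC₁ : 0 ≤ C₁) (hC₂ : 0 ≤ C₂)
    (hWb : ∀ z ∈ ball, ‖W z‖ ≤ C₁ + C₂ / (1 - nsq z))
    (hW0 : ∀ z ∈ ball, star (lift3 z) ⬝ᵥ (J *ᵥ X.ballCoord (xm 0)) = 0 →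
      star (lift3 z) ⬝ᵥ (J *ᵥ X.ballCoord (xm 1)) = 0 → W z ≠ 0)
    (κ : ℝ) (hκ : 0 ≤ κ)
    (hP : ∀ z ∈ ball, X.gaussFree D xm z =
      κ * (‖star (lift3 z) ⬝ᵥ (J *ᵥ X.ballCoord (xm 0))‖ ^ 2 * ‖star (lift3 z) ⬝ᵥ (J *ᵥ X.ballCoord (xm 1))‖ ^ 2 /
        (1 - nsq z) ^ 4 * ‖W z‖ ^ 2)) :
    ∃ A k : ℝ, 0 ≤ A ∧ 0 ≤ k ∧ X.DilationComparison D xm A k := by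
  have hzs := commonZero_mem_ball (X.ballCoord (xm 0)) (X.ballCoord (xm 1)) hab hpos
  have hW0' : W (commonZero (X.ballCoord (xm 0)) (X.ballCoord (xm 1))) ≠ 0 :=
    hW0 _ hzs (jform_lift3_commonZero_left _ _ hab) (jform_lift3_commonZero_right _ _ hab)
  obtain ⟨A, k, hA, hk, h⟩ :=
    exists_shape_comparison (X.ballCoord (xm 0)) (X.ballCoord (xm 1)) hab hpos W hWc hC₁ hC₂ hWb hW0'
  refine ⟨A, k, hA, hk, fun lam hlam a b ha ha2 hb hb2 => ?_⟩
  obtain ⟨hint, hle⟩ := h lam hlam a b ha ha2 hb hb2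
  have heq : ∀ α β : ℝ, Set.EqOn (X.dilInt D xm α β)
      (fun z => κ * shapeInt (X.ballCoord (xm 0)) (X.ballCoord (xm 1)) W α β z) ball :=
    fun α β z hz => X.dilInt_eq_shapeInt D xm hpos W κ hP α β hz
  constructor
  · have h' : IntegrableOn (fun z => κ * shapeInt (X.ballCoord (xm 0)) (X.ballCoord (xm 1)) W (lam * a) (lam * b) z)
        ball := hint.const_mul κ
    exact IntegrableOn.congr_fun h' (fun z hz => (heq _ _ hz).symm) isOpen_ball.measurableSet
  · rw [setIntegral_congr_fun isOpen_ball.measurableSet (heq (lam * a) (lam * b)),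
      setIntegral_congr_fun isOpen_ball.measurableSet (heq (2 * lam) (2 * lam)), integral_const_mul,
      integral_const_mul]
    calc κ * ∫ z in ball, shapeInt (X.ballCoord (xm 0)) (X.ballCoord (xm 1)) W (lam * a) (lam * b) z
        ≤ κ * (A * (2 / a) ^ k * (2 / b) ^ k *
            ∫ z in ball, shapeInt (X.ballCoord (xm 0)) (X.ballCoord (xm 1)) W (2 * lam) (2 * lam) z) := by
          gcongr
      _ = A * (2 / a) ^ k * (2 / b) ^ k *
            (κ * ∫ z in ball, shapeInt (X.ballCoord (xm 0)) (X.ballCoord (xm 1)) W (2 * lam) (2 * lam) z) := by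
          ring

end T4Data

end Summit.Ventures.HodgeRepro.Tier4.Line3

end
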